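import Summits.FinalStateConjecture.FinalStateConjecture.Theses.EIHFluxBalance

/-!
# Sketch — crux `InertialRecession` (item stmt-FinalStateConjecture-17403, route EIHFluxBalance), crux-ideate round 1,
# ideator 1: card `clean-excision-has-a-rate` — First lemma(s)

* `integratedClusterBalance_of_excision` — FIRST LEMMA (Mathlib-only): the abstract expanding system of the registered
  `stub_incrementOracle` (kinematics + WINDOW LAW + IDENTIFICATION) PLUS the new hypothesis (EXC) "clean excision with a rate in
  scale" ⟹ the INTEGRATED CLUSTER BALANCE for every member set isolated by set-distance `r(s)`: increments of `Σ_S Mⱼγⱼvⱼ`, `Σ_S Mⱼγⱼ`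
  over `[t₁,t₂]` are `≤ ζ₀(t₁) + C₀ ∫ min(r,s)^{-3/2}` — identification paid twice, re-partitions free.
* `incrementOracle_of_integratedClusterBalance` — the registered ORACLE(Q) conclusion of `stub_incrementOracle` (verbatim) from the
  integrated cluster balance (sawtooth integral over ballistic passages; slowness of `S` unused).
* `incrementOracle_of_excision` — the two composed: `stub_incrementOracle` with ONE extra hypothesis (EXC).
* `stub_cleanExcision` — the GR side: (EXC) for the Landau–Lifshitz charges of the true lab metric, hypotheses verbatim those of the
  proved `stub_identification` (pseudotensor bound, antecedent block, `0 < N`, Slaved³, QS); corollary of the landed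
  `LLGauss.perforatedGauss_law`, `ll_bulk_decay_bound`, `abs_emComplex_le_of_pseudotensorBound`, `lab_sphereConditions`.
All four elaborate; bodies are `sorry` (ideation stage, no skeleton).
-/

set_option linter.dupNamespace false

noncomputable section

namespace Summit.FinalStateConjecture.FinalStateConjecture.Cruxes.InertialRecession.CleanExcision

open scoped BigOperators Topology Manifold Classical MeasureTheory Matrix InnerProductSpace ContDiff ENNReal
open Filter Set Function TopologicalSpace MeasureTheory Literature.Geometry.Lorentzian
open Summit.FinalStateConjecture.FinalStateConjecture.Theses.EIHFluxBalance

/-- **FIRST LEMMA — INTEGRATED CLUSTER BALANCE from WINDOW LAW + IDENTIFICATION + CLEAN EXCISION (Mathlib-only).** Hypotheses 1–12 are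
verbatim those of the registered `stub_incrementOracle`; hypothesis 13 is (EXC): at equal times, a δ-admissible window minus a disjoint family of
δ-admissible sub-windows carrying the same members differs in charge by `≤ C·Rm^{-1/2}`, `Rm` the smallest radius (a rate in SCALE, uniform in
time). Conclusion: for every member set `S` isolated from its outsiders by set-distance `r(s)` on `[t₁,t₂]`, the kinematic energy–momentum of `S`
changes by at most `ζ₀(t₁) + C₀∫min(r,s)^{-3/2}` — no slowness, no tightness, no bound on the number of re-partitions. [folklore] -/
theorem integratedClusterBalance_of_excision :
    ∀ (N : ℕ) (M : Fin N → ℝ) (ξ v : Fin N → ℝ → E3) (κ : ℝ) (P : ℝ → E3 → ℝ → Fin 4 → ℝ), (∀ i, 0 < M i) → 0 < κ → κ < 1 → (∀ i, ContDiff ℝ ((⊤ : ℕ∞) : WithTop ℕ∞) (ξ i)) → (∀ i, ∀ᶠ t in atTop, ‖ξ i t‖ ≤ κ ^ 2 * t) → (∀ i j, i ≠ j → Tendsto (fun t ↦ ‖ξ i t - ξ j t‖) atTop atTop) → (∀ i, Continuous (v i)) → (∃ k : ℝ, 0 ≤ k ∧ k < 1 ∧ ∀ i t, ‖v i t‖ ≤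 k) → (∀ i, Tendsto (fun t ↦ deriv (ξ i) t - v i t) atTop (𝓝 0)) → (∀ ρ : ℝ → ℝ, Tendsto ρ atTop atTop → ∀ δ : ℝ, 0 < δ → δ < 1 → ∃ (C T : ℝ), ∀ (t₁ t₂ : ℝ) (c : ℝ → E3) (R : ℝ → ℝ), T ≤ t₁ → t₁ ≤ t₂ → (∀ s ∈ Set.Icc t₁ t₂, ∀ s' ∈ Set.Icc t₁ t₂, ‖c s - c s'‖ ≤ 2 * |s - s'| ∧ |R s - R s'| ≤ 2 * |s - s'|) → (∀ s ∈ Set.Icc t₁ t₂, ρ s ≤ δ * R s ∧ ‖c s‖ + R s ≤ (κ + κ ^ 2) / 2 * s ∧ ∀ j, ‖ξ j s - c s‖ ≤ (1 - δ) * R s ∨ (1 + δ) * R s ≤ ‖ξ j s - c s‖) → ∀ μ : Fin 4, |P t₂ (c t₂) (R t₂) μ - P t₁ (c t₁) (R t₁) μ| ≤ C * ∫ s in t₁..t₂, (R s ^ (3 / 2 : ℝ))⁻¹) → (∀ ρ : ℝ → ℝ, Tendsto ρ atTop atTop → ∀ δ : ℝ, 0 < δ → δ < 1 → ∃ (T :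 ℝ) (ζ : ℝ → ℝ), Tendsto ζ atTop (𝓝 0) ∧ ∀ (t : ℝ) (c : E3) (R : ℝ) (A : Finset (Fin N)), T ≤ t → ρ t ≤ δ * R → ‖c‖ + R ≤ (κ + κ ^ 2) / 2 * t → (∀ j, ‖ξ j t - c‖ ≤ (1 - δ) * R ∨ (1 + δ) * R ≤ ‖ξ j t - c‖) → (∀ j, j ∈ A ↔ ‖ξ j t - c‖ ≤ (1 - δ) * R) → |P t c R 0 - ∑ j ∈ A, M j * (√(1 - ‖v j t‖ ^ 2))⁻¹| ≤ ζ t ∧ ∀ k : Fin 3, |P t c R k.succ - ∑ j ∈ A, M j * (√(1 - ‖v j t‖ ^ 2))⁻¹ * v j t k| ≤ ζ t) → (∀ ρ : ℝ → ℝ, Tendsto ρ atTop atTop → ∀ δ : ℝ, 0 < δ → δ < 1 → ∃ (C T : ℝ), ∀ (t : ℝ) (c : E3) (R Rm : ℝ) (m : ℕ) (c' : Fin m → E3) (R' : Fin m → ℝ), T ≤ t → 0 < Rm → ρ t ≤ δ * Rm → Rm ≤ R → (∀ k, Rm ≤ R' k) → ‖c‖ + R ≤ (κ + κ ^ 2)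 / 2 * t → (∀ j, ‖ξ j t - c‖ ≤ (1 - δ) * R ∨ (1 + δ) * R ≤ ‖ξ j t - c‖) → (∀ k j, ‖ξ j t - c' k‖ ≤ (1 - δ) * R' k ∨ (1 + δ) * R' k ≤ ‖ξ j t - c' k‖) → (∀ k, ‖c' k - c‖ + (1 + δ) * R' k ≤ (1 - δ) * R) → (∀ k l, k ≠ l → (1 + δ) * (R' k + R' l) ≤ ‖c' k - c' l‖) → (∀ j, ‖ξ j t - c‖ ≤ (1 - δ) * R → ∃ k, ‖ξ j t - c' k‖ ≤ (1 - δ) * R' k) → ∀ μ : Fin 4, |P t c R μ - ∑ k, P t (c' k) (R' k) μ| ≤ C * (√Rm)⁻¹) → ∃ (C₀ T₀ : ℝ) (ζ₀ : ℝ → ℝ), Tendsto ζ₀ atTop (𝓝 0) ∧ ∀ (S : Finset (Fin N)) (t₁ t₂ : ℝ) (r : ℝ → ℝ), T₀ ≤ t₁ → t₁ ≤ t₂ → S.Nonempty → ContinuousOn r (Set.Icc t₁ t₂) → (∀ s ∈ Set.Icc t₁ t₂, 0 < r s ∧ ∀ i ∈ S, ∀ j ∉ S, r s ≤ ‖ξ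 i s - ξ j s‖) → ‖∑ j ∈ S, (M j * (√(1 - ‖v j t₂‖ ^ 2))⁻¹) • v j t₂ - ∑ j ∈ S, (M j * (√(1 - ‖v j t₁‖ ^ 2))⁻¹) • v j t₁‖ ≤ ζ₀ t₁ + C₀ * ∫ s in t₁..t₂, ((min (r s) s) ^ (3 / 2 : ℝ))⁻¹ ∧ |∑ j ∈ S, M j * (√(1 - ‖v j t₂‖ ^ 2))⁻¹ - ∑ j ∈ S, M j * (√(1 - ‖v j t₁‖ ^ 2))⁻¹| ≤ ζ₀ t₁ + C₀ * ∫ s in t₁..t₂, ((min (r s) s) ^ (3 / 2 : ℝ))⁻¹ := by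
  sorry

/-- **ORACLE(Q) of `stub_incrementOracle` (verbatim conclusion) from the integrated cluster balance**: ballistic outsiders give
`r(s) ≥ max(A₀, (W/2)|s − s_{ij}|)` pairwise, so `∫min(r,s)^{-3/2} ≤ N²·C/(W√A₀) + 2t₁^{-1/2} → 0`; internal slowness of `S` is not used. [folklore] -/
theorem incrementOracle_of_integratedClusterBalance :
    ∀ (N : ℕ) (M : Fin N → ℝ) (ξ v : Fin N → ℝ → E3) (κ : ℝ) (P : ℝ → E3 → ℝ → Fin 4 → ℝ), (∀ i, 0 < M i) → 0 < κ → κ < 1 → (∀ i, ContDiff ℝ ((⊤ : ℕ∞) : WithTop ℕ∞) (ξ i)) → (∀ i, ∀ᶠ t in atTop, ‖ξ i t‖ ≤ κ ^ 2 * t) → (∀ i j, i ≠ j → Tendsto (fun t ↦ ‖ξ i t - ξ j t‖) atTop atTop) → (∀ i, Continuous (v i)) → (∃ k : ℝ, 0 ≤ k ∧ k < 1 ∧ ∀ i t, ‖v i t‖ ≤ k) → (∀ i, Tendsto (fun t ↦ deriv (ξ i) t - v i t) atTop (𝓝 0)) → (∃ (C₀ T₀ : ℝ) (ζ₀ : ℝ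 → ℝ), Tendsto ζ₀ atTop (𝓝 0) ∧ ∀ (S : Finset (Fin N)) (t₁ t₂ : ℝ) (r : ℝ → ℝ), T₀ ≤ t₁ → t₁ ≤ t₂ → S.Nonempty → ContinuousOn r (Set.Icc t₁ t₂) → (∀ s ∈ Set.Icc t₁ t₂, 0 < r s ∧ ∀ i ∈ S, ∀ j ∉ S, r s ≤ ‖ξ i s - ξ j s‖) → ‖∑ j ∈ S, (M j * (√(1 - ‖v j t₂‖ ^ 2))⁻¹) • v j t₂ - ∑ j ∈ S, (M j * (√(1 - ‖v j t₁‖ ^ 2))⁻¹) • v j t₁‖ ≤ ζ₀ t₁ + C₀ * ∫ s in t₁..t₂, ((min (r s) s) ^ (3 / 2 : ℝ))⁻¹ ∧ |∑ j ∈ S, M j * (√(1 - ‖v j t₂‖ ^ 2))⁻¹ - ∑ j ∈ S, M j * (√(1 - ‖v j t₁‖ ^ 2))⁻¹| ≤ ζ₀ t₁ + C₀ * ∫ s in t₁..t₂, ((min (r s) s) ^ (3 / 2 : ℝ))⁻¹) → ∃ Q : ℝ, 400 ≤ Q ∧ (∀ Ω : ℝ, 0 < Ω → ∀ Wlo : ℝ,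 0 < Wlo → ∃ T₀ : ℝ, ∀ (S : Finset (Fin N)) (t₁ t₂ W : ℝ), T₀ ≤ t₁ → t₁ ≤ t₂ → Wlo ≤ W → S.Nonempty → (∀ s ∈ Set.Icc t₁ t₂, ∀ k ∈ S, ∀ l ∈ S, ‖v k s - v l s‖ ≤ 30 * W / Q) → (∀ i ∈ S, ∀ j ∉ S, ∃ n : E3, ‖n‖ = 1 ∧ ∀ s ∈ Set.Icc t₁ t₂, W / 2 ≤ inner ℝ (deriv (ξ j) s - deriv (ξ i) s) n) → ‖∑ j ∈ S, (M j * (√(1 - ‖v j t₂‖ ^ 2))⁻¹) • v j t₂ - ∑ j ∈ S, (M j * (√(1 - ‖v j t₁‖ ^ 2))⁻¹) • v j t₁‖ ≤ Ω ∧ |∑ j ∈ S, M j * (√(1 - ‖v j t₂‖ ^ 2))⁻¹ - ∑ j ∈ S, M j * (√(1 - ‖v j t₁‖ ^ 2))⁻¹| ≤ Ω) := by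
  sorry

/-- **`stub_incrementOracle` with ONE extra hypothesis (EXC)** — the composition of the two lemmas above; this is what the line's
composition would consume in place of the open Mathlib stub. [folklore] -/
theorem incrementOracle_of_excision :
    ∀ (N : ℕ) (M : Fin N → ℝ) (ξ v : Fin N → ℝ → E3) (κ : ℝ) (P : ℝ → E3 → ℝ → Fin 4 → ℝ), (∀ i, 0 < M i) → 0 < κ → κ < 1 → (∀ i, ContDiff ℝ ((⊤ : ℕ∞) : WithTop ℕ∞) (ξ i)) → (∀ i, ∀ᶠ t in atTop, ‖ξ i t‖ ≤ κ ^ 2 * t) → (∀ i j, i ≠ j → Tendsto (fun t ↦ ‖ξ i t - ξ j t‖) atTop atTop) → (∀ i, Continuous (v i)) → (∃ k : ℝ, 0 ≤ k ∧ k < 1 ∧ ∀ i t, ‖v i t‖ ≤ k) → (∀ i, Tendsto (fun t ↦ deriv (ξ i) t - v i t) atTop (𝓝 0)) → (∀ ρ : ℝ → ℝ, Tendsto ρ atTop atTop → ∀ δ : ℝ, 0 < δ → δ < 1 → ∃ (C T : ℝ), ∀ (t₁ t₂ : ℝ) (c : ℝ → E3) (R : ℝ → ℝ), T ≤ t₁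 → t₁ ≤ t₂ → (∀ s ∈ Set.Icc t₁ t₂, ∀ s' ∈ Set.Icc t₁ t₂, ‖c s - c s'‖ ≤ 2 * |s - s'| ∧ |R s - R s'| ≤ 2 * |s - s'|) → (∀ s ∈ Set.Icc t₁ t₂, ρ s ≤ δ * R s ∧ ‖c s‖ + R s ≤ (κ + κ ^ 2) / 2 * s ∧ ∀ j, ‖ξ j s - c s‖ ≤ (1 - δ) * R s ∨ (1 + δ) * R s ≤ ‖ξ j s - c s‖) → ∀ μ : Fin 4, |P t₂ (c t₂) (R t₂) μ - P t₁ (c t₁) (R t₁) μ| ≤ C * ∫ s in t₁..t₂, (R s ^ (3 / 2 : ℝ))⁻¹) → (∀ ρ : ℝ → ℝ, Tendsto ρ atTop atTop → ∀ δ : ℝ, 0 < δ → δ < 1 → ∃ (T : ℝ) (ζ : ℝ → ℝ), Tendsto ζ atTop (𝓝 0) ∧ ∀ (t : ℝ) (c : E3) (R : ℝ) (A : Finset (Fin N)), T ≤ t → ρ t ≤ δ * R → ‖c‖ + R ≤ (κ + κ ^ 2) / 2 * t → (∀ j, ‖ξ j t - c‖ ≤ (1 - δ) * R ∨ (1 +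 δ) * R ≤ ‖ξ j t - c‖) → (∀ j, j ∈ A ↔ ‖ξ j t - c‖ ≤ (1 - δ) * R) → |P t c R 0 - ∑ j ∈ A, M j * (√(1 - ‖v j t‖ ^ 2))⁻¹| ≤ ζ t ∧ ∀ k : Fin 3, |P t c R k.succ - ∑ j ∈ A, M j * (√(1 - ‖v j t‖ ^ 2))⁻¹ * v j t k| ≤ ζ t) → (∀ ρ : ℝ → ℝ, Tendsto ρ atTop atTop → ∀ δ : ℝ, 0 < δ → δ < 1 → ∃ (C T : ℝ), ∀ (t : ℝ) (c : E3) (R Rm : ℝ) (m : ℕ) (c' : Fin m → E3) (R' : Fin m → ℝ), T ≤ t → 0 < Rm → ρ t ≤ δ * Rm → Rm ≤ R → (∀ k, Rm ≤ R' k) → ‖c‖ + R ≤ (κ + κ ^ 2) / 2 * t → (∀ j, ‖ξ j t - c‖ ≤ (1 - δ) * R ∨ (1 + δ) * R ≤ ‖ξ j t - c‖) → (∀ k j, ‖ξ j t - c' k‖ ≤ (1 - δ) * R' k ∨ (1 + δ) * R' k ≤ ‖ξ j t - c' k‖) → (∀ k, ‖c' k - c‖ + (1 + δ) * R' k ≤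 (1 - δ) * R) → (∀ k l, k ≠ l → (1 + δ) * (R' k + R' l) ≤ ‖c' k - c' l‖) → (∀ j, ‖ξ j t - c‖ ≤ (1 - δ) * R → ∃ k, ‖ξ j t - c' k‖ ≤ (1 - δ) * R' k) → ∀ μ : Fin 4, |P t c R μ - ∑ k, P t (c' k) (R' k) μ| ≤ C * (√Rm)⁻¹) → ∃ Q : ℝ, 400 ≤ Q ∧ (∀ Ω : ℝ, 0 < Ω → ∀ Wlo : ℝ, 0 < Wlo → ∃ T₀ : ℝ, ∀ (S : Finset (Fin N)) (t₁ t₂ W : ℝ), T₀ ≤ t₁ → t₁ ≤ t₂ → Wlo ≤ W → S.Nonempty → (∀ s ∈ Set.Icc t₁ t₂, ∀ k ∈ S, ∀ l ∈ S, ‖v k s - v l s‖ ≤ 30 * W / Q) → (∀ i ∈ S, ∀ j ∉ S, ∃ n : E3, ‖n‖ = 1 ∧ ∀ s ∈ Set.Icc t₁ t₂, W / 2 ≤ inner ℝ (deriv (ξ j) s - deriv (ξ i) s) n) → ‖∑ j ∈ S, (M j * (√(1 - ‖v j t₂‖ ^ 2))⁻¹) • v j t₂ - ∑ j ∈ S,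 (M j * (√(1 - ‖v j t₁‖ ^ 2))⁻¹) • v j t₁‖ ≤ Ω ∧ |∑ j ∈ S, M j * (√(1 - ‖v j t₂‖ ^ 2))⁻¹ - ∑ j ∈ S, M j * (√(1 - ‖v j t₁‖ ^ 2))⁻¹| ≤ Ω) := by
  sorry

/-- **GR side — CLEAN EXCISION for the lab charges (the new stub; hypotheses verbatim those of the PROVED `stub_identification`).**
The perforated region between a δ-admissible window and its δ-admissible sub-windows is `δRm`-clear of all painted centres and inside the middle
cone, so `perforatedGauss_law` + `Ric(Φ^*g) = 0` + the pseudotensor bound + `‖∂(labMetric)‖ ≤ K d^{-7/4}` (`lab_sphereConditions`, which consumes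
QS) + `ll_bulk_decay_bound` give `|P(big) − Σ P(small)| ≤ C_PTB K² N 8π (δRm)^{-1/2}`. [folklore] -/
theorem stub_cleanExcision :
        (∃ C : ℝ, 0 ≤ C ∧ ∀ (g : E4 → E4 →L[ℝ] E4 →L[ℝ] ℝ) (x : E4) (b : ℝ), ContDiffAt ℝ 2 g x → (∀ᶠ y in 𝓝 x, ∀ v w : E4, g y v w = g y w v) → ‖g x - Minkowski.bilin‖ ≤ 1 / 2 → (∀ v : E4, ‖fderiv ℝ g x v‖ ≤ b * ‖v‖) → ∀ μ ν : Fin 4, |LandauLifshitz.metricDet g x * LandauLifshitz.pseudotensor g x μ ν| ≤ C * b ^ 2) →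
    ∀ (X : Type) [TopologicalSpace X] [ChartedSpace E3 X] [IsManifold (𝓡 3) ((⊤ : ℕ∞) : WithTop ℕ∞) X] [T2Space X] [SecondCountableTopology X] [ConnectedSpace X], ∀ D ∈ admissibleVacuumData X, ∀ 𝒟 : VacuumCauchyDevelopment D, 𝒟.IsMaximal → ∀ (N : ℕ) (M a rin : Fin N → ℝ) (Λ : Fin N → ℝ → lorentzGroup) (ξ : Fin N → ℝ → E3) (γ κ τ₀ : ℝ) (U : Opens E4) (Φ : U → 𝒟.carrier) (O : Set 𝒟.carrier), ((∀ i, Kerr.IsSubextremal (M i) (a i) ∧ Kerr.rMinus (M i) (a i) < rin i ∧ rin i < Kerr.rPlus (M i) (a i)) ∧ (∀ i t, |((Λ i t : E4 ≃L[ℝ] E4) (E4.basisVector 0)) 0| ≤ γ) ∧ (∀ i, ContDiff ℝ ((⊤ : ℕ∞) : WithTop ℕ∞) (ξ i) ∧ ContDiff ℝ ((⊤ : ℕ∞) : WithTop ℕ∞) (fun t ↦ ((Λ i t : E4 ≃L[ℝ] E4) : E4 →L[ℝ] E4))) ∧ (∀ i j, i ≠ j → Tendsto (fun t ↦ ‖ξ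 i t - ξ j t‖) atTop atTop) ∧ (0 < κ ∧ κ < 1 ∧ ∀ i, ∀ᶠ t in atTop, ‖ξ i t‖ ≤ κ ^ 2 * t) ∧ ({x : E4 | τ₀ < x 0 ∧ ∀ i, rin i < Kerr.radius (a i) (poincareInv (Λ i (x 0)) (E4.ofTimeSpace (x 0) (ξ i (x 0))) x)} ⊆ (U : Set E4)) ∧ let B : ModelBackground := ⟨U, fun x ↦ Minkowski.bilin + ∑ i, (boostedKerrBilin (Λ i (x 0)) (E4.ofTimeSpace (x 0) (ξ i (x 0))) (M i) (a i) x - Minkowski.bilin), fun x ↦ x 0, E4.spatialNorm⟩; ContMDiff 𝓘(ℝ, E4) (𝓡 4) ((⊤ : ℕ∞) : WithTop ℕ∞) Φ ∧ Topology.IsOpenEmbedding ((B.lateRegion τ₀).restrict Φ) ∧ Φ '' {x : U | τ₀ < x.1 0 ∧ ∀ i, Kerr.rPlus (M i) (a i) < Kerr.radius (a i) (poincareInv (Λ i (x.1 0)) (E4.ofTimeSpace (x.1 0) (ξ i (x.1 0))) x.1)} ⊆ O ∧ Tendsto (fun t ↦ 𝒟.toSpacetime.deviationCk B Φ 3 t)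 atTop (𝓝 0) ∧ Tendsto (fun t : ℝ ↦ ⨆ x ∈ {x : U | x.1 0 = t ∧ E4.spatialNorm x.1 ≤ κ * t}, ⨆ (m : ℕ) (_ : m ≤ 3), ENNReal.ofReal (1 + √(√((⨅ i, ‖E4.spatial x.1 - ξ i t‖) ^ 7))) * ‖iteratedFDeriv ℝ m (𝒟.toSpacetime.deviationExtend B Φ) x.1‖ₑ) atTop (𝓝 0) ∧ O = Summit.FinalStateConjecture.exteriorOf 𝒟.toCauchyDevelopment (Φ '' {x : U | τ₀ < x.1 0 ∧ ∀ i, Kerr.rPlus (M i) (a i) < Kerr.radius (a i) (poincareInv (Λ i (x.1 0)) (E4.ofTimeSpace (x.1 0) (ξ i (x.1 0))) x.1)}) ∧ ∀ t₁ : ℝ, τ₀ < t₁ → O \ Φ '' {x : U | t₁ < x.1 0 ∧ ∀ i, Kerr.rPlus (M i) (a i) < Kerr.radius (a i) (poincareInv (Λ i (x.1 0)) (E4.ofTimeSpace (x.1 0) (ξ i (x.1 0))) x.1)} ⊆ 𝒟.metric.causalPast 𝒟.timeOrientation (Φ '' {x : U | x.1 0 = t₁ ∧ ∀ i, Kerr.rPlus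 (M i) (a i) < Kerr.radius (a i) (poincareInv (Λ i (x.1 0)) (E4.ofTimeSpace (x.1 0) (ξ i (x.1 0))) x.1)})) → 0 < N →
    (∀ i : Fin N, (∀ m : ℕ, 1 ≤ m → m ≤ 3 → Tendsto (fun t ↦ iteratedDeriv m (fun s ↦ (((Λ i s : lorentzGroup) : E4 ≃L[ℝ] E4) (E4.basisVector 0))) t) atTop (𝓝 0)) ∧ (∀ m : ℕ, m ≤ 2 → Tendsto (fun t ↦ iteratedDeriv m (fun s ↦ deriv (ξ i) s - (((((Λ i s : lorentzGroup) : E4 ≃L[ℝ] E4) (E4.basisVector 0)) 0)⁻¹ • E4.spatial (((Λ i s : lorentzGroup) : E4 ≃L[ℝ] E4) (E4.basisVector 0)))) t) atTop (𝓝 0)) ∧ (a i ≠ 0 → ∀ m : ℕ, 1 ≤ m → m ≤ 3 → Tendsto (fun t ↦ iteratedDeriv m (fun s ↦ (((Λ i s : lorentzGroup) : E4 ≃L[ℝ] E4) (E4.basisVector 3))) t) atTop (𝓝 0))) →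
    (∀ ρ : ℝ → ℝ, Tendsto ρ atTop atTop → Tendsto (fun t : ℝ ↦ ⨆ x ∈ {x : E4 | x 0 = t ∧ E4.spatialNorm x ≤ κ * t ∧ ρ t ≤ ⨅ i, ‖E4.spatial x - ξ i t‖}, ENNReal.ofReal (1 + √(√((⨅ i, ‖E4.spatial x - ξ i t‖) ^ 7))) * ‖fderiv ℝ (fun y : E4 ↦ Minkowski.bilin + ∑ i, (boostedKerrBilin (Λ i (y 0)) (E4.ofTimeSpace (y 0) (ξ i (y 0))) (M i) (a i) y - Minkowski.bilin)) x (E4.basisVector 0)‖ₑ) atTop (𝓝 0)) →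
    (∀ ρ : ℝ → ℝ, Tendsto ρ atTop atTop → ∀ δ : ℝ, 0 < δ → δ < 1 → ∃ (C T : ℝ), ∀ (t : ℝ) (c : E3) (R Rm : ℝ) (m : ℕ) (c' : Fin m → E3) (R' : Fin m → ℝ), T ≤ t → 0 < Rm → ρ t ≤ δ * Rm → Rm ≤ R → (∀ k, Rm ≤ R' k) → ‖c‖ + R ≤ (κ + κ ^ 2) / 2 * t → (∀ j, ‖ξ j t - c‖ ≤ (1 - δ) * R ∨ (1 + δ) * R ≤ ‖ξ j t - c‖) → (∀ k j, ‖ξ j t - c' k‖ ≤ (1 - δ) * R' k ∨ (1 + δ) * R' k ≤ ‖ξ j t - c' k‖) → (∀ k, ‖c' k - c‖ + (1 + δ) * R' k ≤ (1 - δ) * R) → (∀ k l, k ≠ l → (1 + δ) * (R' k + R' l) ≤ ‖c' k - c' l‖) → (∀ j, ‖ξ j t - c‖ ≤ (1 - δ) * R → ∃ k, ‖ξ j t - c' k‖ ≤ (1 - δ) * R' k) → ∀ μ : Fin 4, |(LandauLifshitz.quasiLocalMomentum (fun x : E4 ↦ (Minkowski.bilin + ∑ i, (boostedKerrBilin (Λ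 i (x 0)) (E4.ofTimeSpace (x 0) (ξ i (x 0))) (M i) (a i) x - Minkowski.bilin)) + 𝒟.toSpacetime.deviationExtend (⟨U, fun x ↦ Minkowski.bilin + ∑ i, (boostedKerrBilin (Λ i (x 0)) (E4.ofTimeSpace (x 0) (ξ i (x 0))) (M i) (a i) x - Minkowski.bilin), fun x ↦ x 0, E4.spatialNorm⟩ : ModelBackground) Φ x)) t c R μ - ∑ k, (LandauLifshitz.quasiLocalMomentum (fun x : E4 ↦ (Minkowski.bilin + ∑ i, (boostedKerrBilin (Λ i (x 0)) (E4.ofTimeSpace (x 0) (ξ i (x 0))) (M i) (a i) x - Minkowski.bilin)) + 𝒟.toSpacetime.deviationExtend (⟨U, fun x ↦ Minkowski.bilin + ∑ i, (boostedKerrBilin (Λ i (x 0)) (E4.ofTimeSpace (x 0) (ξ i (x 0))) (M i) (a i) x - Minkowski.bilin), fun x ↦ x 0, E4.spatialNorm⟩ : ModelBackground) Φ x)) t (c' k) (R' k) μ| ≤ C * (√Rm)⁻¹) := by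
  sorry

end Summit.FinalStateConjecture.FinalStateConjecture.Cruxes.InertialRecession.CleanExcision

end
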